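import Literature.MathematicalPhysics.KineticTheory.LangevinSemigroup
import Mathlib.Analysis.SpecialFunctions.Pow.Real
import HarnessLib

/-!
# Barrier (AtomisticToContinuum / FouriersLaw): pinning stronger than coupling — breathers, no spectral gap

`Literature/Barriers/AtomisticToContinuum/` (D-0021 barrier catalogue), sub-problem `FouriersLaw`
(`Literature.MathematicalPhysics.KineticTheory.HeatConduction.FouriersLaw`, `Literature/MathematicalPhysics/KineticTheory/FouriersLaw.lean`),
whose clause (i) is existence AND uniqueness of the non-equilibrium steady state of the
Langevin-driven chain for every length `N`.

## Source

M. Hairer, J. C. Mattingly, *Slow energy dissipation in anharmonic oscillator chains*,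
Comm. Pure Appl. Math. **62** (2009) 999–1032 (arXiv:0712.3884). Model (§1, the display defining
`H(p,q)` and the equations of motion that follow it; §2, the three-oscillator system):
`N + 1` oscillators `H = ∑ (p_i²/2 + V₁(q_i)) + ∑ V₂(q_i - q_{i-1})`, Langevin baths
`-γ₀p₀ dt + √(2γ₀T₀) dw₀`, `-γ_N p_N dt + √(2γ_N T_N) dw_N` on the two end particles, with
HOMOGENEOUS PINNING `V₁(q) = |q|^{2k}/(2k)` and HARMONIC COUPLING `V₂(q) = q²/2`, `k > 1`
("the pinning potential is stronger then the coupling potential").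

Printed statements used here (locators of the arXiv version: Abstract, §1, Thm 3.11, Rem 3.12,
Thm 3.13 (in §3.3), Prop 5.1, Rem 5.2, Thm 5.6; citation keys inside quotations are expanded to
author–year):

* Abstract: "When the chain is of length three and `k > 3/2` we show that there exists a unique
  invariant measure. If `k > 2` we further show that the system does not relax exponentially fast
  to this equilibrium by demonstrating that zero is in the essential spectrum of the generator of
  the dynamics. When the chain has five or more oscillators and `k > 3/2` we show that the
  generator again has zero in its essential spectrum."
* §1: "even the existence of an invariant probability measure is an open problem in some cases as
  simple as `V₁(q) = q⁴` and `V₂(q) = q²`." … "It was shown in [Eckmann–Hairer 2000, 2003] that if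
  `V₁(q)` and `V₂(q)` behave approximately like `|q|^{a₁}` and `|q|^{a₂}` respectively at infinity
  then, provided that `a₂ > a₁ > 2`, there exists a unique invariant measure … the generator `L` …
  has compact resolvent in every space of the form `L²(exp(-H(p,q)/T) dp dq)` with
  `T > max{T₀,T_N}/2`. In [Rey-Bellet–Thomas 2002], it was also shown … that the condition
  `a₂ ≥ a₁ ≥ 2` is sufficient for the existence and uniqueness of an invariant measure" …
  "Even in the simplest possible scenario, that is when `V₁(q) = q⁴` and `V₂(q) = q²`, we will
  show in Theorem 3.11 below that the compactness property of the resolvent of `L` is destroyed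
  as soon as `N+1 ≥ 3`. Furthermore, when `N+1 ≥ 5`, it will be shown in Theorem 3.13 that the
  essential spectrum of `L` (always in a weighted `L²` space of the type considered before)
  extends all the way to `0`. These negative results hold even in the case where `T₀ = T_N = T`"
  … "We are at the moment unable to provide a general proof that shows the existence of an
  invariant measure for a chain of arbitrary length." … "the uniqueness of an invariant measure
  for a chain of arbitrary length follows quickly from the hypoellipticity of the generator and
  the Hamiltonian structure once the existence of an invariant measure is established."
* Theorem 3.11 (three oscillators): "If `k ≥ 2`, then the operator `L̃` does not have compact
  resolvent for any `β < 2 min{β₀, β₂}`. If `k > 2`, then it has essential spectrum at `0`."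
  Remark 3.12: "the exact same result also holds for a chain consisting of `4` oscillators".
  Theorem 3.13 (§3.3, chain of length `N + 1`): "If `N+1 ≥ 5` and `k > 3/2`, then the operator `L̃`
  has essential spectrum at `0`. If `k = 3/2`, it does not have compact resolvent. As previously,
  these statements are independent of the value of `β < 2 min{β₀, β_N}`." Abstract: "If `k > 2`
  we further show that the system does not relax exponentially fast to this equilibrium by
  demonstrating that zero is in the essential spectrum of the generator".
* Proposition 5.1 (Kryloff–Bogoliouboff with a Lyapunov function) and Theorem 5.6 (`k > 3/2`:
  a Lyapunov function `𝒱 ≥ cH^α - C`, `L𝒱 ≤ C - cH^{α'}` for the three-oscillator system) give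
  the existence half of the abstract's claim; Remark 5.2: the Lyapunov function gives convergence
  of the transition probabilities at the (upper-bound) rate `O(t^{-α/(1-α)})` in total variation,
  "We believe that this convergence actually takes place at a much faster rate, but such a
  statement is beyond our reach at the moment."

Cuneo–Eckmann–Hairer–Rey-Bellet 2018, §1 (paragraph following condition C5): "Without C5,
decoupling phenomena (related to “breathers”) may lead to subexponential convergence to the
invariant measure (and much more difficult proofs). In fact, the existence of the invariant
measure when the pinning potentials grow faster than the interaction potentials has only been
obtained for a chain of 3 masses so far (see the extensive discussion in [Hairer–Mattingly 2009]),
and for some closely related chains of rotors, which correspond to the “infinite pinning” limit in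
a sense (see [Cuneo–Eckmann–Poquet 2015, Cuneo–Eckmann 2016, Cuneo–Poquet 2017])."

## Contents (`homogeneouslyPinnedChain` in `Literature.HeatConduction`; the barrier fact in `Literature.Barriers.AtomisticToContinuum`)

* `homogeneouslyPinnedChain k γ` — the HM model as an `OscillatorChain` (`U = |q|^{2k}/(2k)`,
  `V = r²/2`, equal frictions `γ₀ = γ_N = γ`); `homogeneouslyPinnedChain_two_U/V`: for `k = 2`
  it has the potentials of the discrete `φ⁴` chain `phi4Chain 0 1 γ` of `FouriersLaw.lean`.
* `HairerMattingly2009_threeOscillators` — NAMED FACT (abstract + Prop 5.1/Thm 5.6 + §1): for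
  three oscillators and `k > 3/2` there is a Markov semigroup of the chain (interface
  `LangevinChainSemigroup`, packaged existentially exactly as `CuneoEckmannHairerReyBellet2018_thm213`)
  with exactly one invariant probability measure. The negative spectral statements (Thm 3.11,
  Rem 3.12, Thm 3.13) are recorded in the docstring block only: Mathlib has no essential spectrum / compact
  resolvent for unbounded non-self-adjoint generators, so they are not restated as Lean `Prop`s.

## Design notes

* Equal frictions and the tree's bath convention (sites `0` and `N - 1`, BLR 2000 eq. (10)) are a
  specialisation of HM's `γ₀, γ_N > 0`; temperatures are taken positive (HM: `σ_i² = 2γ_iT_i`).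
* `Real.rpow` with the nonnegative base `|q|`; for `k = 2`, `|q|^4/4 = q⁴/4` (proved below).
-/

noncomputable section

open MeasureTheory Filter Topology

namespace Literature.Barriers.AtomisticToContinuum.HeatConduction

/-- The Hairer–Mattingly chain: homogeneous pinning `U(q) = |q|^{2k}/(2k)` of degree `2k`,
harmonic coupling `V(r) = r²/2`, bath friction `γ` (HM 2009 §1, Hamiltonian and equations of
motion; §2, three oscillators; here `γ₀ = γ_N = γ`). [cite: HairerMattingly2009, §1 and §2] -/
def homogeneouslyPinnedChain (k γ : ℝ) : Literature.MathematicalPhysics.KineticTheory.HeatConduction.OscillatorChain where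
  U q := |q| ^ (2 * k) / (2 * k)
  V r := r ^ 2 / 2
  γ := γ

/-- For `k = 2` the Hairer–Mattingly pinning is the pure quartic pinning of the discrete `φ⁴`
chain `phi4Chain 0 1 γ` (`|q|⁴/4 = q⁴/4`). [folklore] -/
theorem homogeneouslyPinnedChain_two_U (γ q : ℝ) :
    (homogeneouslyPinnedChain 2 γ).U q = (Literature.MathematicalPhysics.KineticTheory.HeatConduction.phi4Chain 0 1 γ).U q := by
  have h : |q| ^ ((2 : ℝ) * 2) = q ^ 4 := by
    rw [show ((2 : ℝ) * 2) = ((4 : ℕ) : ℝ) by norm_num, Real.rpow_natCast]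
    have : |q| ^ 4 = (|q| ^ 2) ^ 2 := by ring
    rw [this, sq_abs]; ring
  simp only [homogeneouslyPinnedChain, Literature.MathematicalPhysics.KineticTheory.HeatConduction.phi4Chain, h]
  ring

/-- The Hairer–Mattingly coupling is the harmonic coupling of `phi4Chain`. [folklore] -/
theorem homogeneouslyPinnedChain_V (k γ r : ℝ) :
    (homogeneouslyPinnedChain k γ).V r = (Literature.MathematicalPhysics.KineticTheory.HeatConduction.phi4Chain 0 1 γ).V r := rfl

end Literature.Barriers.AtomisticToContinuum.HeatConduction

namespace Literature.Barriers.AtomisticToContinuum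

open Literature.MathematicalPhysics.KineticTheory.HeatConduction HeatConduction

/-- Hairer–Mattingly 2009 (abstract; Prop 5.1 with Thm 5.6; §1): the THREE-oscillator chain with homogeneous pinning `|q|^{2k}/(2k)`, `k > 3/2`, harmonic coupling and Langevin baths at both ends at temperatures `T_L, T_R > 0` has a unique invariant (probability) measure — "When the chain is of length three and `k > 3/2` we show that there exists a unique invariant measure" — vendored, like `CuneoEckmannHairerReyBellet2018_thm213`, as: there is a Markov semigroup of the chain (interface `LangevinChainSemigroup`) with exactly one invariant probability measure. This positive result is the printed EXTENT of NESS existence theory when the pinning dominates the coupling; the accompanying no-go theorems are recorded in the block below.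
BARRIER (D-0021), AtomisticToContinuum/FouriersLaw:
technique_class: exponential-lyapunov-function geometric-drift-harris spectral-gap-hypocoercivity compact-resolvent weighted-L2-spectral-gap exponential-ergodicity; BARRIER AUDIT 2026-08-15 (NARROWED — `StrongPinningBreathersNarrow` in `StrongPinningBreathersNarrow.lean`, all conjuncts proved, axioms `propext, Classical.choice, Quot.sound`): of this token class the printed theorems cover exactly the COMPACT-RESOLVENT / WEIGHTED-`L²`-SPECTRAL-GAP sub-class — statements about the conjugated generator `L̃` on the Gibbs-weighted Hilbert spaces `L²(e^{-βH}dp dq)`, `β < 2 min{β₀, β_N}` [cite: HairerMattingly2009, Thm 3.11 and Rem 3.12 and Thm 3.13]; NOT covered by any printed theorem although inside the wording `exponential-lyapunov-function geometric-drift-harris exponential-ergodicity`: the spectral gap in `L²(μ)` for the steady state itself ("a natural conjecture … The next section is a step towards a proof of this conjecture" [cite: HairerMattingly2009, §2.2 Claim 2]), `V`-uniform (Harris) geometric ergodicity in weighted total variation for `V = e^{θH}` or any other weight, and every LOWER bound on the convergence rate — the lower-bound criterion [cite: Hairer2009, §3.3] is printed only for the two-oscillator infinite-temperature model [cite: Hairer2009,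 Thm 1.1] and for rotors [cite: CuneoPoquet2017, Thm 1.1]; and the regime map is finer than "pinning stronger than coupling": with the source's decay exponent `γ(k,n) = 2n/k + 1 - 2n` (`n` bonds from the central site to the nearest bath) nothing is printed for `N ∈ {3,4}` sites with `1 < k < 2` (model: compact resolvent) nor for `N ≥ 5` with `1 < k < 3/2`, and for the `φ⁴` chain (`k = 2`) with `N ∈ {3,4}` a spectral gap WITHOUT compact resolvent is the model prediction (`γ = 0`) [cite: HairerMattingly2009, §2.2 Claim 2] — see the narrowed block for the full `(k, N)` table
blocks: for Langevin chains whose pinning grows faster than the coupling — the Hairer–Mattingly model `V₁ = |q|^{2k}/2k`, `V₂ = q²/2`, `k > 1`, e.g. the discrete `φ⁴` chain `phi4Chain ω₂ lam γ` (`lam > 0`, harmonic coupling; `phi4Chain 0 1 γ = homogeneouslyPinnedChain 2 γ`): (α) compact-resolvent arguments à la Eckmann–Hairer 2000, for `N + 1 ≥ 3` oscillators and `k ≥ 2` [cite: HairerMattingly2009, Thm 3.11 and Rem 3.12] (and `k = 3/2`, `N + 1 ≥ 5` [cite: HairerMattingly2009, Thm 3.13]); (β) spectral-gap / exponential-ergodicity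 arguments in `L²(e^{-βH}dp dq)`, for `k > 2` with `N + 1 ∈ {3, 4}` [cite: HairerMattingly2009, Thm 3.11 and Rem 3.12] and for `k > 3/2` with `N + 1 ≥ 5` [cite: HairerMattingly2009, Thm 3.13] — in particular for the `φ⁴` chain (`k = 2`) with `≥ 5` sites; so clause (i) of `OscillatorChain.FouriersLawFor` (steady state exists and is unique for EVERY `N`) has at present no proof for such chains: "even the existence of an invariant probability measure is an open problem in some cases as simple as `V₁(q) = q⁴` and `V₂(q) = q²`" [cite: HairerMattingly2009, §1], "has only been obtained for a chain of 3 masses so far" [cite: CuneoEckmannHairerReyBellet2018, §1 (paragraph after condition C5)]. NOT blocked: the conjunct's `pinnedChain ω₂ lam β γ`, `β > 0` (interaction degree `4 ≥` pinning degree, condition C5) [cite: CuneoEckmannHairerReyBellet2018, Thm 2.13]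
because: breathers — when `V₁` dominates `V₂` at high energy the interaction is suppressed and energy stays trapped in the bulk [cite: HairerMattingly2009, §1]; approximate invariant measures concentrated on such states yield: no compact resolvent for `k ≥ 2` and three (four) oscillators, and essential spectrum at `0` for `k > 2` with three (four) oscillators and for `k > 3/2` with five or more, for every `β < 2 min{β₀, β_N}` and even at equal temperatures [cite: HairerMattingly2009, Thm 3.11 and Rem 3.12 and Thm 3.13]; hence in these cases "the system does not relax exponentially fast" [cite: HairerMattingly2009, Abstract], while the compact-resolvent mechanism requires `a₂ > a₁ > 2` and the exponential Lyapunov/Harris mechanism `a₂ ≥ a₁` (condition C5) [cite: HairerMattingly2009, §1] [cite: CuneoEckmannHairerReyBellet2018, Thm 2.13]; where existence IS proved (three oscillators) the proved convergence rate is polynomial, `O(t^{-α/(1-α)})` in total variation [cite: HairerMattingly2009, Rem 5.2]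
evasions_known: (a) three oscillators, `k > 3/2`: averaging out the fast breather oscillation gives effective dynamics and a POLYNOMIAL-type Lyapunov function `𝒱 ≥ cH^α - C`, `L𝒱 ≤ C - cH^{α'}`, whence existence by Kryloff–Bogoliouboff and uniqueness by hypoellipticity [cite: HairerMattingly2009, Thm 5.6 and Prop 5.1]; (b) the closely related rotor chains ("infinite pinning" limit): unique steady state with stretched-exponential (subgeometric) ergodicity for three rotors [cite: CuneoEckmannPoquet2015, Abstract] and four rotors [cite: CuneoEckmann2016, Abstract], the stretched exponent `1/2` being optimal for short chains [cite: CuneoPoquet2017, Abstract] — the way around cited in [cite: CuneoEckmannHairerReyBellet2018, §1 (paragraph after condition C5)]; (c) the two-oscillator toy model with one bath at infinite temperature is classified completely, including NON-existence of an invariant probability measure for `k > 2`, algebraic convergence at `k = 2` (small `T_∞`) and stretched-exponential convergence for `4/3 ≤ k < 2` [cite: Hairer2009, Thm 1.1]; (d) choosing the interaction at least as stiff as the pinning (condition C5) restores existence, uniqueness and exponential convergence for every `N` [cite: CuneoEckmannHairerReyBellet2018, Thm 2.13]; earlier, for `a₂ > a₁ > 2`, existence and uniqueness with compact resolvent (Eckmann–Hairer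 2000, condition as restated in [cite: HairerMattingly2009, §1]) [cite: EckmannHairer2000, Abstract]
scope_caveats: the no-go results are SPECTRAL statements for the Hairer–Mattingly model only (homogeneous pinning `|q|^{2k}/2k`, HARMONIC coupling; three or four oscillators in Thm 3.11/Rem 3.12, five or more in Thm 3.13), in the weighted spaces `L²(e^{-βH}dp dq)`, `β < 2 min{β₀, β₂}` — absence of compact resolvent, resp. `0` in the essential spectrum, hence no exponential relaxation IN THOSE SPACES; they do NOT assert non-existence of the invariant measure (proved to exist for three oscillators, expected in general) nor rule out other function spaces or non-spectral (e.g. averaging/effective-dynamics) constructions [cite: HairerMattingly2009, §1 and Rem 5.2]; nothing is asserted about chains satisfying condition C5, such as the conjunct's `pinnedChain ω₂ lam β γ` with `β > 0`; the Lean fact records only the positive three-oscillator theorem (`γ₀ = γ_N`, temperatures `> 0`), the spectral theorems are cited but not formalised (Mathlib has no essential spectrum for unbounded non-self-adjoint operators); polynomial (non-exponential) Lyapunov functions and subgeometric Harris theorems are NOT blocked — they are exactly the evasions (a)–(b); for the four-site `φ⁴` chain (`k = 2`, `N + 1 = 4`) only 'no compact resolvent' is printed [cite: HairerMattingly2009,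 Rem 3.12], no statement about the spectral gap; BARRIER AUDIT 2026-08-15: the same holds for the THREE-site `φ⁴` chain (Thm 3.11 gives `0 ∈ σ_e` only for `k > 2`), and for both the source's model predicts a spectral gap (`γ(2,1) = 0`) [cite: HairerMattingly2009, §2.2 Claim 2]; a POINTWISE generator drift `LV ≤ C - cH^α` for an energy-only `V = F(H)` fails for EVERY chain (`L(F∘H)(q,0) = γ(T_L+T_R)F'(H) ≥ 0`, proved in `StrongPinningBreathersNarrow.lean`), so `exponential-lyapunov-function` is to be read as the time-integrated drift of [cite: CuneoEckmannHairerReyBellet2018, §3 eq. (3.3)]; existence for `N + 1 ≥ 4` re-confirmed open as of 2024 ("when the pinning dominates, the mixing is proven only for a chain of `N = 3` oscillators") [cite: DymovLokutsievskiySarychev2024, §5]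
status: theorem (established): [cite: HairerMattingly2009, Thm 3.11 and Thm 3.13 and Thm 5.6]; existence for `N + 1 ≥ 4` open as stated in [cite: HairerMattingly2009, §1] and [cite: CuneoEckmannHairerReyBellet2018, §1 (paragraph after condition C5)]
[cite: HairerMattingly2009, Abstract and Thm 5.6 with Prop 5.1] -/
def HairerMattingly2009_threeOscillators : Prop :=
  ∀ k γ : ℝ, 3 / 2 < k → 0 < γ → ∀ T_L T_R : ℝ, 0 < T_L → 0 < T_R →
    ∃ S : LangevinChainSemigroup (homogeneouslyPinnedChain k γ) 3 T_L T_R,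
      ∃! μ : Measure (PhaseSpace 3), IsProbabilityMeasure μ ∧ S.IsInvariant μ

/-- Unfolding: the fact yields, for `k = 2` (pure quartic pinning), a semigroup of the
three-site chain with a unique invariant probability measure. [cite: HairerMattingly2009, Abstract] -/
theorem HairerMattingly2009_threeOscillators.quartic (h : HairerMattingly2009_threeOscillators)
    {γ T_L T_R : ℝ} (hγ : 0 < γ) (hL : 0 < T_L) (hR : 0 < T_R) :
    ∃ S : LangevinChainSemigroup (homogeneouslyPinnedChain 2 γ) 3 T_L T_R,
      ∃! μ : Measure (PhaseSpace 3), IsProbabilityMeasure μ ∧ S.IsInvariant μ :=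
  h 2 γ (by norm_num) hγ T_L T_R hL hR

end Literature.Barriers.AtomisticToContinuum

end
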